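import Literature.Geometry.Lorentzian.CauchyDevelopment
import Literature.Geometry.Lorentzian.CausalityOpennessProofs
import Literature.Geometry.Lorentzian.Stationary
import Literature.Geometry.Lorentzian.Geodesic
import Literature.Geometry.Lorentzian.Volume
import Literature.Geometry.Lorentzian.AsymptoticFlatness
import Literature.Geometry.Lorentzian.NullInfinity
import HarnessLib

/-!
# Event horizons of Cauchy developments relative to a far region, and the area of their sections

For a Cauchy development `𝒟 = (M, g, τ, ι, ν)` of an initial data set `D` on `X`
(`Literature.Geometry.Lorentzian.CauchyDevelopment`, the repaired carrier) and a subset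
`U ⊆ M` — meant to be a **far charted region standing in for future null infinity `𝓘⁺`**
(e.g. the late image of an asymptotically flat chart, as in `Development.exteriorOf`,
`Literature.Geometry.Lorentzian.FinalState`) — this file defines

* `CauchyDevelopment.blackHoleRegion 𝒟 U = J⁺(ι X) ∖ I⁻(U)`: the events to the future of the
  data from which no timelike signal reaches `U` (Hawking–Ellis 1973, §9.2, `B = M ∖ J⁻(𝓘⁺)`;
  Wald 1984, (12.1.1); Chruściel–Costa 2008, (2.3), with `𝓘⁺` replaced by `U`; it is
  `J⁺(ι X) ∩ Spacetime.blackHoleRegionOfEnd U`, `blackHoleRegion_eq_inter_blackHoleRegionOfEnd`);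
* `CauchyDevelopment.eventHorizon 𝒟 U = ∂I⁻(U) ∩ J⁺(ι X)`: the (future) **event horizon**
  relative to `U`, the achronal boundary of the past of `U` cut down to the future of the data
  (Hawking–Ellis 1973, §9.2, `J̇⁻(𝓘⁺)`; Wald 1984, (12.1.2), `H = J̇⁻(𝓘⁺) ∩ M`);
* the **hypothesis structure** `EventHorizonArea 𝒟 U` (`X` a `3`-manifold): an *advanced-time
  foliation* of the event horizon, i.e. a real-indexed family of smooth, spacelike, achronal,
  embedded hypersurfaces `σ_v : L → M` (`v ∈ ℝ`, one leaf type `L`) to the future of the data,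
  carrying their induced Riemannian metrics `h_v = σ_v^* g` as data, whose horizon sections
  `S_v = σ_v(L) ∩ 𝓗⁺` are compact, cover `𝓗⁺`, and are causally ordered (`S_v ⊆ J⁻(S_w)` for
  `v ≤ w`); and `EventHorizonArea.horizonArea A v = area h_v (σ_v⁻¹ 𝓗⁺)`, the **area of the
  section `S_v`**: its `2`-dimensional Euclidean-normalised Hausdorff measure for the length
  metric of `h_v` (`Volume.lean`, `area = riemannianVolume · 2`), which is exactly the notion of
  area of sections of (rough) horizons of Chruściel–Delay–Galloway–Howard, Ann. Henri Poincaré 2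
  (2001), §3, eq. (3.11): `Area(S) = ℌ²_h(S)`, `h` the metric induced by `g` on the slicing
  hypersurface (loc. cit., Prop. 3.3: `S` is Borel; Prop. 3.4: rectifiable);
* the **area theorem** in the differentiability-free form of Chruściel–Delay–Galloway–Howard
  2001, Thm. 1.1, case (b) (= Thm. 6.1 with Prop. 4.17): for a future horizon `𝓗` (closed,
  achronal, topological hypersurface, ruled by null geodesics) whose generators are future
  complete, with the null energy condition on `𝓗`, and two achronal spacelike `C²` hypersurfaces
  `Σ₁`, `Σ₂` with `Σ₁ ∩ 𝓗 ⊆ J⁻(Σ₂ ∩ 𝓗)`: `Area(Σ₁ ∩ 𝓗) ≤ Area(Σ₂ ∩ 𝓗)` — vendored as the named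
  fact `ChruscielEtAl2001_areaTheorem` (dimension `3 + 1`, smooth leaves), with the auxiliary
  notions `IsTopologicalSubmanifold`, `Spacetime.IsRuledByCompleteNullGeodesics`,
  `Spacetime.SatisfiesNullConvergenceOn`, and the proved bridges
  `EventHorizonArea.monotone_horizonArea` (`Monotone A.horizonArea` from the fact and its
  hypotheses on `∂I⁻(U)`) and `VacuumCauchyDevelopment.monotone_horizonArea` (vacuum: the null
  energy condition is automatic);
* the **Penrose heuristic bound on the horizon area**, `|S| ≤ 16π E_ADM²` for cuts `S` of the
  event horizon (Penrose 1973; Mars, CQG 26 (2009) 193001, §2), recorded as an OPEN statement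
  **schema** `PenroseHorizonAreaBound IsPastOfNullInfinity` in the identification
  `I⁻(U) = M ∩ J⁻(𝓘⁺)` it presupposes (design note below); nothing is asserted about it.

## Design notes

* **Why `∂I⁻(U) ∩ J⁺(ι X)` and not `∂𝓑`.** The request suggested `𝓗⁺ := ∂𝓑 ∩ J⁺(ι X)` with
  `𝓑 = J⁺(ι X) ∖ I⁻(U)`. If black holes are already present on the initial slice, `∂𝓑` contains
  the interior points of `𝓑 ∩ ι X` (just below them lies the past of `ι X`, outside `J⁺(ι X)`),
  which are not horizon points. The achronal boundary `∂I⁻(U)` has no such artefact, and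
  `eventHorizon ⊆ 𝓑`, `eventHorizon ⊆ ∂𝓑` hold (`eventHorizon_subset_blackHoleRegion`,
  `eventHorizon_subset_frontier_blackHoleRegion`; `I⁻(U)` is open,
  `LorentzianMetric.isOpen_chronologicalPast_of_boundaryless`). It is Wald's `H = J̇⁻(𝓘⁺) ∩ M`
  restricted to the future development `J⁺(ι X)` of the data.
* **Leaves carry their metric as data.** As in `DataEmbedding.induced_h`, each leaf comes with a
  Riemannian metric `h_v` on the leaf type and the equation `σ_v^* g = h_v` (so `σ_v` is
  spacelike); this avoids threading the smoothness-of-pullback fact `contMDiff_pullbackBilin`.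
  Since `σ_v : (L, h_v) → (σ_v(L), g|)` is then an isometry onto its image, `area h_v (σ_v⁻¹ 𝓗⁺)`
  is the Hausdorff area of `S_v` for the induced metric, CDGH (3.11). One leaf type `L` for all
  `v` (level sets of a time function near the horizon are diffeomorphic); the leaf type is a
  field with its instances (pattern of `OutermostMOTS`, `TrappedSurface.lean`), including the
  measurable structure required by `Volume.lean`.
* **What the structure does not demand.** No disjointness of different sections (CDGH, Rem. 6.2:
  the plain area inequality needs none), no regularity of `𝓗⁺` or of the sections (they are
  merely compact subsets of the leaves; CDGH Prop. 3.3–3.4), no finiteness of the areas (compact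
  sections of horizons are `2`-rectifiable, CDGH Prop. 3.4, hence of finite area, but that is a
  theorem not vendored here), and nothing tying `U` to null infinity: whether `∂I⁻(U)` *is* the
  event horizon of the physical spacetime is a property of `U` the user supplies (for `U` the
  late image of a far chart extending to all later times it is; for a time-bounded `U` it is
  not — `∂I⁻(U)` is then a null cone far from any black hole).
* **The area theorem is stated for an abstract horizon `𝓗 ⊆ M`**, verbatim after CDGH: their
  Thm. 1.1 (b) concerns "a black hole event horizon `𝓗`" whose generators are future complete,
  and their §4.2 stresses that for this case "`𝓗` is not necessarily an event horizon, and the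
  space–time does not have to satisfy any causality conditions" — the operative statement is
  Thm. 6.1 (area monotonicity for any future horizon with `θ_𝒜l ≥ 0`) with Prop. 4.17
  (`θ_𝒜l ≥ 0` under hypothesis (b)). "Future horizon" (CDGH §2): a closed, achronal, embedded
  topological hypersurface, future null geodesically ruled (every point lies on a
  future-inextendible null geodesic contained in `𝓗`, past endpoints allowed); we render
  "ruled by future complete generators" pointwise (`IsRuledByCompleteNullGeodesics`: through
  every point a future-directed null geodesic `γ|[a, ∞) ⊆ 𝓗`, affinely parametrised on all of
  `[a, ∞)`), which under achronality is the printed hypothesis (two null generators through one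
  point in different directions would produce a chronology violation inside `𝓗`). The bridge to
  the structure feeds `𝓗 := ∂I⁻(U)` (closed: `isClosed_frontier`; the leaves lie in `J⁺(ι X)`,
  so `σ_v⁻¹(∂I⁻(U)) = σ_v⁻¹(𝓗⁺)`, `crossSection_eq_preimage_frontier`); the remaining hypotheses
  (achronality and hypersurface property of the achronal boundary `∂I⁻(U)` — Penrose 1972 /
  Hawking–Ellis Prop. 6.3.1 —, complete generators, NEC) are hypotheses of the bridge.
* **The Penrose bound is a schema.** Penrose's heuristic inequality `M_ADM ≥ √(|S|/16π)` for a
  cut `S` of the event horizon `∂J⁻(𝓘⁺)` by an asymptotically flat slice (Mars 2009, §2: area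
  theorem + settling to Kerr + `A_Kerr ≤ 16π M²` + Bondi mass loss + Bondi → ADM) presupposes
  that the horizon is taken relative to a complete `𝓘⁺`. In the `𝓘⁺`-free language of this file
  that is the identification `I⁻(U) = M ∩ J⁻(𝓘⁺)`, which no intrinsic predicate of the tree
  expresses (cf. the design note of `FinalState.lean` on `futureExterior`); for an arbitrary `U`
  the inequality is simply false (small `U`: `∂I⁻(U)` is a large null cone). Exactly as for the
  `I⁺`-regularity hypothesis of `stationary_black_hole_uniqueness` (`BlackHoles.lean`), the
  identification therefore enters as a **predicate parameter** `IsPastOfNullInfinity 𝒟 U`, and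
  `PenroseHorizonAreaBound IsPastOfNullInfinity` is the statement "for maximal vacuum Cauchy
  developments with complete future null infinity of asymptotically flat one-ended data with ADM
  energy `E`, every section of an advanced-time foliation of `𝓗⁺(U)`, `U` a past-of-`𝓘⁺` proxy,
  has area `≤ 16π E²`". It is open at the intended instance and asserted at none; no citation tag
  presents it as a theorem.

## Mathlib

Mathlib (pin) has no Lorentzian causality, horizons, or Hausdorff area on manifolds beyond what
`Volume.lean` assembles (`μHE[d]` of the Riemannian length metric). Used: `frontier`,
`IsClosed`/`IsCompact`, `Homeomorph` (`≃ₜ`), `Manifold.IsSmoothEmbedding`,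
`Bundle.ContMDiffRiemannianMetric`, `ChartedSpace.locallyCompactSpace`, `Monotone`,
`ENNReal.ofReal`; from the Lorentz prelude: `CauchyDevelopment`, `VacuumCauchyDevelopment`,
`causalFuture`/`chronologicalPast`/`causalPast`, `IsAchronal`, `Spacetime.blackHoleRegionOfEnd`,
`isOpen_chronologicalPast_of_boundaryless`, `IsGeodesicOn`, `velocity`, `leviCivita`, `ricci`,
`IsNull`, `IsFutureDirected`, `pullbackBilin`, `area`, `AFEnd.admEnergy`/`HasADMEnergy`/
`IsAsymptoticallyFlat`/`IsSoleEnd`, `HasCompleteFutureNullInfinity`.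

## References

* P. T. Chruściel, E. Delay, G. J. Galloway, R. Howard, *Regularity of horizons and the area
  theorem*, Ann. Henri Poincaré 2 (2001) 109–178, arXiv:gr-qc/0001003: §2 (future horizons),
  §3 (sections; Prop. 3.3, Prop. 3.4, eq. (3.11) `Area(S) = ℌ^{n-1}_h(S)`), Thm. 1.1, §4.2 and
  Prop. 4.17 (complete generators), Thm. 6.1 and Rem. 6.2 (key `ChruscielEtAl2001`).
* S. W. Hawking, G. F. R. Ellis, *The large scale structure of space-time*, CUP 1973, §6.3
  (achronal boundaries, Prop. 6.3.1), §9.2 (black holes, event horizon, area theorem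
  Prop. 9.2.7) (key `HawkingEllis1973`).
* R. M. Wald, *General Relativity*, Chicago 1984, §12.1, (12.1.1)–(12.1.2), §12.2 (area
  theorem, Thm. 12.2.6) (key `Wald1984`).
* R. Penrose, *Naked singularities*, Ann. New York Acad. Sci. 224 (1973) 125–134 (key
  `Penrose1973`).
* M. Mars, *Present status of the Penrose inequality*, Class. Quantum Grav. 26 (2009) 193001,
  arXiv:0906.5566, §2 (heuristic derivation of `M_ADM ≥ √(|S|/16π)` for horizon cuts) (key
  `Mars2009`).
* M. Dafermos, J. Luk, arXiv:1710.01722, Conjecture 1 (b) ("a smooth future affine complete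
  horizon `𝓗⁺`") (key `DafermosLuk2017`).
-/

noncomputable section

open Manifold Bundle Set Topology MeasureTheory Filter
open scoped ContDiff ENNReal

universe u

namespace Literature.Geometry.Lorentzian

/-! ### Topological submanifolds; sets ruled by future-complete null geodesics -/

section General

/-- `S ⊆ M` is an **(embedded) topological submanifold of dimension `m`**: with the subspace
topology, `S` is locally homeomorphic to open subsets of `ℝᵐ` (every point of `S` has an open
neighbourhood in `S` homeomorphic to an open subset of `EuclideanSpace ℝ (Fin m)`). For
`m = dim M − 1` this is an *embedded topological hypersurface*, the regularity class of horizons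
in Chruściel–Delay–Galloway–Howard 2001, §2 ("`𝓗` is an achronal, closed, future null
geodesically ruled topological hypersurface"; "hypersurfaces are assumed to be embedded").
Hausdorffness and second countability are inherited from `M`. [cite: ChruscielEtAl2001, §2] -/
def IsTopologicalSubmanifold {M : Type*} [TopologicalSpace M] (m : ℕ) (S : Set M) : Prop :=
  ∀ p : S, ∃ V : Set S, IsOpen V ∧ p ∈ V ∧
    ∃ W : Set (EuclideanSpace ℝ (Fin m)), IsOpen W ∧ Nonempty (V ≃ₜ W)

end General

namespace Spacetime

variable {d : ℕ} (𝓢 : Spacetime.{u} d)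

/-- The subset `𝓗` of the spacetime `𝓢` is **ruled by future-complete null geodesics**: through
every point `p ∈ 𝓗` passes a future-directed null geodesic ray `γ|[a, ∞)` of the Levi-Civita
connection of `g` (`IsGeodesicOn … γ (Ici a)`, so the affine parameter runs over all of
`[a, ∞)`: the ray is *future complete*, in particular future inextendible; `γ a` may be a past
endpoint) which stays in `𝓗`, `γ([a, ∞)) ⊆ 𝓗`, with `p = γ t₀` for some `t₀ ≥ a`. This is the
conjunction "`𝓗` is future null geodesically ruled" (Chruściel–Delay–Galloway–Howard 2001, §2:
"every point `p ∈ 𝓗` belongs to a future inextensible null geodesic `Γ ⊆ 𝓗`; … the generators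
are allowed to have past endpoints on `𝓗`, but no future endpoints") and "the generators of `𝓗`
are future complete" (loc. cit., Thm. 1.1 (b), §4.2), rendered pointwise; for achronal `𝓗` the
two readings agree (distinct null generators through one point give a broken null path, hence a
chronology violation, inside `𝓗`). Standing hypothesis `[𝓢.metric.HasLeviCivita]`.
[cite: ChruscielEtAl2001, §2 and Thm. 1.1 (b)] -/
def IsRuledByCompleteNullGeodesics [𝓢.metric.HasLeviCivita] (𝓗 : Set 𝓢.carrier) : Prop :=
  ∀ p ∈ 𝓗, ∃ (γ : ℝ → 𝓢.carrier) (a t₀ : ℝ), a ≤ t₀ ∧ γ t₀ = p ∧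
    IsGeodesicOn 𝓢.metric.leviCivita γ (Ici a) ∧
    (∀ t ∈ Ici a, 𝓢.metric.IsNull (velocity (𝓡 d) γ t) ∧
      𝓢.timeOrientation.IsFutureDirected (velocity (𝓡 d) γ t)) ∧
    MapsTo γ (Ici a) 𝓗

/-- The **null energy (null convergence) condition holds on the subset `A`** of the spacetime
`𝓢`: `Ric(v, v) ≥ 0` for every null vector `v` at every point of `A` (Ricci tensor of the
Levi-Civita connection, standing hypothesis `[𝓢.metric.HasLeviCivita]`). The pointwise-localised
form of `LorentzianMetric.SatisfiesNullConvergence` (Hawking–Ellis 1973, §4.3, p. 95), as used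
in Chruściel–Delay–Galloway–Howard 2001, Thm. 1.1 (b) ("the null energy condition holds on `𝓗`")
and (4.1). [cite: ChruscielEtAl2001, Thm. 1.1 (b) and (4.1)] -/
def SatisfiesNullConvergenceOn [𝓢.metric.HasLeviCivita] (A : Set 𝓢.carrier) : Prop :=
  ∀ p ∈ A, ∀ v : TangentSpace (𝓡 d) p, 𝓢.metric.IsNull v → 0 ≤ 𝓢.metric.ricci p v v

variable {𝓢}

/-- The null convergence condition of `Einstein.lean` (everywhere) gives it on every subset.
Hawking–Ellis 1973, §4.3, p. 95. [cite: HawkingEllis1973, §4.3, p. 95] -/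
theorem satisfiesNullConvergenceOn_of_satisfiesNullConvergence [𝓢.metric.HasLeviCivita]
    (h : 𝓢.metric.SatisfiesNullConvergence) (A : Set 𝓢.carrier) :
    𝓢.SatisfiesNullConvergenceOn A :=
  fun p _ v hv ↦ h p v hv

/-- A **vacuum** (Ricci-flat) spacetime satisfies the null convergence condition on every subset.
Hawking–Ellis 1973, §4.3, p. 95. [cite: HawkingEllis1973, §4.3, p. 95] -/
theorem satisfiesNullConvergenceOn_of_isRicciFlat [𝓢.metric.HasLeviCivita]
    (h : 𝓢.metric.toPseudoRiemannianMetric.IsRicciFlat) (A : Set 𝓢.carrier) :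
    𝓢.SatisfiesNullConvergenceOn A :=
  satisfiesNullConvergenceOn_of_satisfiesNullConvergence
    (LorentzianMetric.satisfiesNullConvergence_of_isRicciFlat h) A

/-- Restriction to a smaller subset. [folklore] -/
theorem SatisfiesNullConvergenceOn.mono [𝓢.metric.HasLeviCivita] {A B : Set 𝓢.carrier}
    (h : 𝓢.SatisfiesNullConvergenceOn B) (hAB : A ⊆ B) : 𝓢.SatisfiesNullConvergenceOn A :=
  fun p hp v hv ↦ h p (hAB hp) v hv

end Spacetime

/-! ### Black-hole region and event horizon of a Cauchy development relative to a far region -/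

namespace CauchyDevelopment

section Region

variable {n : ℕ} {X : Type u} [TopologicalSpace X] [ChartedSpace (EuclideanSpace ℝ (Fin n)) X]
  [IsManifold (𝓡 n) ∞ X] [ConnectedSpace X] {D : InitialDataSet (𝓡 n) X}

/-- The **black-hole region of the Cauchy development `𝒟` relative to the far region `U`**:
`𝓑 := J⁺(ι X) ∖ I⁻(U)`, the events to the causal future of the data hypersurface from which no
timelike signal reaches `U`. With `U` standing in for (a neighbourhood of the past end of)
future null infinity this is Hawking–Ellis's `B = M ∖ J⁻(𝓘⁺, M̄)` (1973, §9.2) and Wald's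
(12.1.1), restricted to the future development of the data; it is `J⁺(ι X)` intersected with
`Spacetime.blackHoleRegionOfEnd U = M ∖ I⁻(U)` of `Stationary.lean` (Chruściel–Costa 2008,
(2.3)), `blackHoleRegion_eq_inter_blackHoleRegionOfEnd`. Whether `I⁻(U)` is the whole domain of
outer communications is a property of `U`, not asserted here. [cite: Wald1984, §12.1, (12.1.1)] -/
def blackHoleRegion (𝒟 : CauchyDevelopment D) (U : Set 𝒟.carrier) : Set 𝒟.carrier :=
  𝒟.metric.causalFuture 𝒟.timeOrientation (range 𝒟.embed) \
    𝒟.metric.chronologicalPast 𝒟.timeOrientation U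

/-- The **(future) event horizon of the Cauchy development `𝒟` relative to the far region `U`**:
`𝓗⁺ := ∂I⁻(U) ∩ J⁺(ι X)`, the boundary of the chronological past of `U` (an achronal boundary,
Hawking–Ellis 1973, §6.3) cut down to the causal future of the data hypersurface. With `U`
standing in for future null infinity this is Hawking–Ellis's event horizon `J̇⁻(𝓘⁺, M̄)` (1973,
§9.2, p. 312) and Wald's `H = J̇⁻(𝓘⁺) ∩ M` ((12.1.2)), taken in the future development `J⁺(ι X)`.
See the module docstring for why the frontier of `I⁻(U)` rather than that of the black-hole
region is used; `eventHorizon ⊆ blackHoleRegion` and `eventHorizon ⊆ ∂ blackHoleRegion` are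
`eventHorizon_subset_blackHoleRegion`, `eventHorizon_subset_frontier_blackHoleRegion`.
[cite: Wald1984, §12.1, (12.1.2)] -/
def eventHorizon (𝒟 : CauchyDevelopment D) (U : Set 𝒟.carrier) : Set 𝒟.carrier :=
  frontier (𝒟.metric.chronologicalPast 𝒟.timeOrientation U) ∩
    𝒟.metric.causalFuture 𝒟.timeOrientation (range 𝒟.embed)

variable (𝒟 : CauchyDevelopment D) (U : Set 𝒟.carrier)

/-- Unfolding lemma for `blackHoleRegion`. [folklore] -/
theorem mem_blackHoleRegion_iff {p : 𝒟.carrier} :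
    p ∈ 𝒟.blackHoleRegion U ↔
      p ∈ 𝒟.metric.causalFuture 𝒟.timeOrientation (range 𝒟.embed) ∧
        p ∉ 𝒟.metric.chronologicalPast 𝒟.timeOrientation U :=
  Iff.rfl

/-- Unfolding lemma for `eventHorizon`. [folklore] -/
theorem mem_eventHorizon_iff {p : 𝒟.carrier} :
    p ∈ 𝒟.eventHorizon U ↔
      p ∈ frontier (𝒟.metric.chronologicalPast 𝒟.timeOrientation U) ∧
        p ∈ 𝒟.metric.causalFuture 𝒟.timeOrientation (range 𝒟.embed) :=
  Iff.rfl

/-- The black-hole region relative to `U` is the future development part of the black-hole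
region `M ∖ I⁻(U)` of `Stationary.lean` (Chruściel–Costa 2008, (2.3)):
`𝓑 = J⁺(ι X) ∩ blackHoleRegionOfEnd U`. [cite: Wald1984, §12.1, (12.1.1)] -/
theorem blackHoleRegion_eq_inter_blackHoleRegionOfEnd :
    𝒟.blackHoleRegion U =
      𝒟.metric.causalFuture 𝒟.timeOrientation (range 𝒟.embed) ∩
        𝒟.toSpacetime.blackHoleRegionOfEnd U :=
  rfl

/-- The black-hole region lies to the causal future of the data hypersurface. [folklore] -/
theorem blackHoleRegion_subset_causalFuture :
    𝒟.blackHoleRegion U ⊆ 𝒟.metric.causalFuture 𝒟.timeOrientation (range 𝒟.embed) :=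
  sdiff_subset

/-- No point of the black-hole region lies in the chronological past of `U`. Wald 1984, §12.1.
[cite: Wald1984, §12.1, (12.1.1)] -/
theorem disjoint_chronologicalPast_blackHoleRegion :
    Disjoint (𝒟.metric.chronologicalPast 𝒟.timeOrientation U) (𝒟.blackHoleRegion U) :=
  disjoint_sdiff_right

/-- The future development of the data splits into the exterior region `J⁺(ι X) ∩ I⁻(U)`
(`Development.exteriorOf`, `FinalState.lean`) and the black-hole region relative to `U`.
Wald 1984, §12.1. [cite: Wald1984, §12.1, (12.1.1)] -/
theorem inter_chronologicalPast_union_blackHoleRegion :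
    𝒟.metric.causalFuture 𝒟.timeOrientation (range 𝒟.embed) ∩
        𝒟.metric.chronologicalPast 𝒟.timeOrientation U ∪ 𝒟.blackHoleRegion U =
      𝒟.metric.causalFuture 𝒟.timeOrientation (range 𝒟.embed) :=
  inter_union_sdiff _ _

/-- The chronological past `I⁻(U)` is open in the carrier of a Cauchy development (a manifold
without boundary; O'Neill 1983, Ch. 14, Lemma 14.3, proved in `CausalityOpennessProofs`).
[cite: ONeill1983, Ch. 14, Lemma 14.3] -/
theorem isOpen_chronologicalPast :
    IsOpen (𝒟.metric.chronologicalPast 𝒟.timeOrientation U) :=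
  LorentzianMetric.isOpen_chronologicalPast_of_boundaryless 𝒟.metric 𝒟.timeOrientation U

/-- The event horizon lies to the causal future of the data hypersurface. [folklore] -/
theorem eventHorizon_subset_causalFuture :
    𝒟.eventHorizon U ⊆ 𝒟.metric.causalFuture 𝒟.timeOrientation (range 𝒟.embed) :=
  inter_subset_right

/-- The event horizon is part of the achronal boundary `∂I⁻(U)`. Hawking–Ellis 1973, §9.2.
[cite: HawkingEllis1973, §9.2] -/
theorem eventHorizon_subset_frontier :
    𝒟.eventHorizon U ⊆ frontier (𝒟.metric.chronologicalPast 𝒟.timeOrientation U) :=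
  inter_subset_left

/-- The event horizon is disjoint from the chronological past of `U` (which is open, hence
disjoint from its frontier). Wald 1984, §12.1. [cite: Wald1984, §12.1, (12.1.2)] -/
theorem disjoint_eventHorizon_chronologicalPast :
    Disjoint (𝒟.eventHorizon U) (𝒟.metric.chronologicalPast 𝒟.timeOrientation U) := by
  refine Disjoint.mono_left (eventHorizon_subset_frontier 𝒟 U) ?_
  rw [(isOpen_chronologicalPast 𝒟 U).frontier_eq]
  exact disjoint_sdiff_left

/-- The event horizon lies in the black-hole region (`I⁻(U)` being open, its frontier is not
part of it). Wald 1984, §12.1 (`H ⊆ B`). [cite: Wald1984, §12.1, (12.1.2)] -/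
theorem eventHorizon_subset_blackHoleRegion : 𝒟.eventHorizon U ⊆ 𝒟.blackHoleRegion U :=
  fun _ hp ↦ ⟨hp.2, fun h ↦ (disjoint_eventHorizon_chronologicalPast 𝒟 U).le_bot ⟨hp, h⟩⟩

/-- The event horizon lies in the topological frontier of the black-hole region: it is the part
of `∂𝓑` bounding `𝓑` against the exterior `J⁺(ι X) ∩ I⁻(U)` (Wald 1984, (12.1.2): "the
boundary of `B` in `M`"). [cite: Wald1984, §12.1, (12.1.2)] -/
theorem eventHorizon_subset_frontier_blackHoleRegion :
    𝒟.eventHorizon U ⊆ frontier (𝒟.blackHoleRegion U) := by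
  intro p hp
  refine mem_sdiff_of_mem (subset_closure (eventHorizon_subset_blackHoleRegion 𝒟 U hp)) ?_
  intro hint
  have h : p ∈ interior (𝒟.metric.chronologicalPast 𝒟.timeOrientation U)ᶜ :=
    interior_mono (sdiff_subset_compl _ _) hint
  rw [interior_compl] at h
  exact h (frontier_subset_closure hp.1)

/-- Nothing lies in the chronological past of the empty set. [folklore] -/
theorem chronologicalPast_empty : 𝒟.metric.chronologicalPast 𝒟.timeOrientation ∅ = ∅ :=
  eq_empty_of_forall_notMem fun _ ⟨_, hp, _⟩ ↦ hp

/-- Degenerate case `U = ∅` (nothing counts as "far away"): the black-hole region is the whole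
future development `J⁺(ι X)` — recorded to document that the notions of this file are exactly as
meaningful as the far region `U` fed to them. [folklore] -/
theorem blackHoleRegion_empty :
    𝒟.blackHoleRegion ∅ = 𝒟.metric.causalFuture 𝒟.timeOrientation (range 𝒟.embed) := by
  rw [blackHoleRegion, chronologicalPast_empty, sdiff_empty]

/-- Degenerate case `U = ∅`: the event horizon is empty. [folklore] -/
theorem eventHorizon_empty : 𝒟.eventHorizon ∅ = ∅ := by
  rw [eventHorizon, chronologicalPast_empty, frontier_empty, empty_inter]

end Region

end CauchyDevelopment

/-! ### Advanced-time foliations of the event horizon and the area of its sections -/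

section Area

variable {X : Type u} [TopologicalSpace X] [ChartedSpace E3 X] [IsManifold (𝓡 3) ∞ X]
  [ConnectedSpace X] {D : InitialDataSet (𝓡 3) X}

/-- **Areas of the sections of the event horizon along an advanced-time foliation** — a
hypothesis structure. Given a Cauchy development `𝒟` of `3`-dimensional data and a far region
`U ⊆ M` (with event horizon `𝓗⁺ = 𝒟.eventHorizon U = ∂I⁻(U) ∩ J⁺(ι X)`), an
`EventHorizonArea 𝒟 U` consists of

* a leaf `3`-manifold `L` (Hausdorff, with its Borel measurable structure) and, for every
  *advanced time* `v : ℝ`, a smooth embedding `σ_v : L → M` (`Manifold.IsSmoothEmbedding`) whose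
  image is **achronal** and lies to the causal future `J⁺(ι X)` of the data, together with a
  smooth Riemannian metric `h_v` on `L` which **is the induced metric**, `σ_v^* g = h_v` (so
  `σ_v(L)` is a smooth spacelike achronal embedded hypersurface, the class of slicing
  hypersurfaces of Chruściel–Delay–Galloway–Howard 2001, Thm. 1.1: "achronal spacelike embedded
  hypersurfaces of `C²` differentiability class");
* such that the **sections** `S_v := σ_v(L) ∩ 𝓗⁺` are compact (as subsets `σ_v⁻¹(𝓗⁺)` of `L`),
  **cover** the horizon, `𝓗⁺ ⊆ ⋃_v σ_v(L)` (a foliation of `𝓗⁺`; disjointness of distinct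
  sections is not required), and are **causally ordered**: `S_v ⊆ J⁻(S_w)` for `v ≤ w` (the
  hypothesis `S₁ ⊆ J⁻(S₂)` of the area theorem, CDGH Thm. 1.1 / Thm. 6.1).

The area of the section `S_v` is then `EventHorizonArea.horizonArea`. This is the standard
set-up of the area theorem (Hawking–Ellis 1973, §9.2, Prop. 9.2.7: sections `∂B ∩ 𝒮(τ)` of the
horizon by the slices of a time function; CDGH 2001, §3, (3.1) `𝓗_τ = 𝓗 ∩ Σ_τ`), packaged for
the repaired development structure. [cite: ChruscielEtAl2001, §3, (3.1) and Thm. 1.1] -/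
structure EventHorizonArea (𝒟 : CauchyDevelopment D) (U : Set 𝒟.carrier) where
  /-- The leaf type: a `3`-manifold parametrising every slicing hypersurface. -/
  Leaf : Type u
  /-- Topology of the leaf. -/
  [top : TopologicalSpace Leaf]
  /-- The leaf is modelled on `ℝ³`. -/
  [charted : ChartedSpace E3 Leaf]
  /-- The leaf is a smooth manifold. -/
  [mfd : IsManifold (𝓡 3) ∞ Leaf]
  /-- The leaf is Hausdorff. -/
  [t2 : T2Space Leaf]
  /-- Measurable structure of the leaf (for the Hausdorff area, `Volume.lean`). -/
  [meas : MeasurableSpace Leaf]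
  /-- The measurable structure is the Borel one. -/
  [borel : BorelSpace Leaf]
  /-- The slicing hypersurfaces `σ_v : L → M`, indexed by advanced time `v`. -/
  leaf : ℝ → Leaf → 𝒟.carrier
  /-- The induced Riemannian metrics `h_v = σ_v^* g` on the leaf (as data, cf. `induced`). -/
  leafMetric : ℝ → ContMDiffRiemannianMetric (𝓡 3) ∞ E3 (TangentSpace (𝓡 3) : Leaf → Type _)
  /-- Each `σ_v` is a smooth embedding. -/
  isSmoothEmbedding (v : ℝ) : Manifold.IsSmoothEmbedding (𝓡 3) (𝓡 4) ∞ (leaf v)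
  /-- `h_v` is the metric induced by `g` along `σ_v` (in particular `σ_v` is spacelike). -/
  induced (v : ℝ) (y : Leaf) :
    pullbackBilin (I := 𝓡 4) (I' := 𝓡 3) (leaf v) 𝒟.metric.val y = (leafMetric v).inner y
  /-- Each slicing hypersurface is achronal. -/
  isAchronal (v : ℝ) : 𝒟.metric.IsAchronal 𝒟.timeOrientation (range (leaf v))
  /-- Each slicing hypersurface lies to the causal future of the data hypersurface. -/
  range_subset_causalFuture (v : ℝ) :
    range (leaf v) ⊆ 𝒟.metric.causalFuture 𝒟.timeOrientation (range 𝒟.embed)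
  /-- The horizon sections `S_v = σ_v(L) ∩ 𝓗⁺` are compact (as subsets of the leaf). -/
  isCompact_preimage (v : ℝ) : IsCompact (leaf v ⁻¹' 𝒟.eventHorizon U)
  /-- The sections are causally ordered: `S_v ⊆ J⁻(S_w)` for `v ≤ w`. -/
  inter_subset_causalPast ⦃v w : ℝ⦄ (h : v ≤ w) :
    range (leaf v) ∩ 𝒟.eventHorizon U ⊆
      𝒟.metric.causalPast 𝒟.timeOrientation (range (leaf w) ∩ 𝒟.eventHorizon U)
  /-- The slicing hypersurfaces cover the event horizon. -/
  eventHorizon_subset_iUnion : 𝒟.eventHorizon U ⊆ ⋃ v, range (leaf v)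

namespace EventHorizonArea

attribute [instance] top charted mfd t2 meas borel

variable {𝒟 : CauchyDevelopment D} {U : Set 𝒟.carrier}

/-- The leaf of an advanced-time foliation is locally compact (a manifold modelled on `ℝ³`;
Mathlib's `ChartedSpace.locallyCompactSpace`), so that `T3Space Leaf`, needed by the length
metric of `Volume.lean`, is found by instance resolution. [folklore] -/
instance instLocallyCompactSpaceLeaf (A : EventHorizonArea 𝒟 U) : LocallyCompactSpace A.Leaf :=
  ChartedSpace.locallyCompactSpace E3 A.Leaf

/-- The **section of the event horizon at advanced time `v`**, as a subset of the leaf: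
`σ_v⁻¹(𝓗⁺)`, whose image is `S_v = σ_v(L) ∩ 𝓗⁺` (`image_crossSection`). CDGH 2001, §3, (3.1).
[cite: ChruscielEtAl2001, §3, (3.1)] -/
def crossSection (A : EventHorizonArea 𝒟 U) (v : ℝ) : Set A.Leaf :=
  A.leaf v ⁻¹' 𝒟.eventHorizon U

/-- The **area of the event horizon at advanced time `v`**: the area (`Volume.lean`: the
`2`-dimensional Euclidean-normalised Hausdorff measure of the length metric of `h_v`) of the
section `σ_v⁻¹(𝓗⁺)` in the leaf `(L, h_v)`, i.e. `ℌ²_{h_v}(S_v)` for the metric induced on the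
slicing hypersurface — the area of sections of horizons of Chruściel–Delay–Galloway–Howard 2001,
§3, eq. (3.11) (well defined: `S_v` is Borel, loc. cit. Prop. 3.3). Values in `[0, ∞]`.
[cite: ChruscielEtAl2001, §3, (3.11) and Prop. 3.3] -/
def horizonArea (A : EventHorizonArea 𝒟 U) (v : ℝ) : ℝ≥0∞ :=
  area (A.leafMetric v) (A.crossSection v)

variable (A : EventHorizonArea 𝒟 U)

/-- Unfolding lemma for `crossSection`. [folklore] -/
theorem mem_crossSection_iff {v : ℝ} {y : A.Leaf} :
    y ∈ A.crossSection v ↔ A.leaf v y ∈ 𝒟.eventHorizon U :=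
  Iff.rfl

/-- Unfolding lemma: the horizon area is the `2`-dimensional Riemannian volume of the section
in the leaf. [folklore] -/
theorem horizonArea_eq (v : ℝ) :
    A.horizonArea v = riemannianVolume (A.leafMetric v) 2 (A.crossSection v) :=
  rfl

/-- The image of the section in spacetime is `S_v = σ_v(L) ∩ 𝓗⁺`. CDGH 2001, §3, (3.1).
[cite: ChruscielEtAl2001, §3, (3.1)] -/
theorem image_crossSection (v : ℝ) :
    A.leaf v '' A.crossSection v = range (A.leaf v) ∩ 𝒟.eventHorizon U :=
  image_preimage_eq_range_inter

/-- The sections are compact. [folklore] -/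
theorem isCompact_crossSection (v : ℝ) : IsCompact (A.crossSection v) :=
  A.isCompact_preimage v

/-- Each `σ_v` is injective (an embedding). [folklore] -/
theorem injective_leaf (v : ℝ) : Function.Injective (A.leaf v) :=
  (A.isSmoothEmbedding v).isEmbedding.injective

/-- Since the leaves lie in `J⁺(ι X)`, the section is the preimage of the full achronal boundary
`∂I⁻(U)`. [folklore] -/
theorem crossSection_eq_preimage_frontier (v : ℝ) :
    A.crossSection v =
      A.leaf v ⁻¹' frontier (𝒟.metric.chronologicalPast 𝒟.timeOrientation U) :=
  Set.ext fun y ↦ ⟨fun h ↦ h.1, fun h ↦ ⟨h, A.range_subset_causalFuture v ⟨y, rfl⟩⟩⟩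

/-- Since the leaves lie in `J⁺(ι X)`, `σ_v(L) ∩ 𝓗⁺ = σ_v(L) ∩ ∂I⁻(U)`. [folklore] -/
theorem range_inter_eventHorizon_eq (v : ℝ) :
    range (A.leaf v) ∩ 𝒟.eventHorizon U =
      range (A.leaf v) ∩ frontier (𝒟.metric.chronologicalPast 𝒟.timeOrientation U) :=
  Set.ext fun _ ↦
    ⟨fun h ↦ ⟨h.1, h.2.1⟩, fun h ↦ ⟨h.1, h.2, A.range_subset_causalFuture v h.1⟩⟩

/-- The sections lie in the black-hole region. Wald 1984, §12.1.
[cite: Wald1984, §12.1, (12.1.2)] -/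
theorem image_crossSection_subset_blackHoleRegion (v : ℝ) :
    A.leaf v '' A.crossSection v ⊆ 𝒟.blackHoleRegion U := by
  rw [image_crossSection]
  exact inter_subset_right.trans (CauchyDevelopment.eventHorizon_subset_blackHoleRegion 𝒟 U)

end EventHorizonArea

end Area

/-! ### The area theorem (Chruściel–Delay–Galloway–Howard 2001), complete-generator case -/

/-- **The area theorem, without differentiability hypotheses on the horizon, for horizons with
future-complete generators** (Chruściel–Delay–Galloway–Howard, Ann. Henri Poincaré 2 (2001),
Thm. 1.1, case (b); precisely Thm. 6.1 (first conclusion, standard areas, together with Rem. 6.2)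
combined with Prop. 4.17), in dimension `3 + 1` and for smooth slicing hypersurfaces.
Let `(M, g)` be a smooth spacetime (here: a `Spacetime 4`, with the Levi-Civita connection of
`g`) and `𝓗 ⊆ M` a *future horizon* — a closed, achronal, embedded topological hypersurface
which is future null geodesically ruled — whose generators are **future complete**
(`Spacetime.IsRuledByCompleteNullGeodesics`), and suppose the **null energy condition** holds on
`𝓗` (`Ric(v, v) ≥ 0` for null `v` at points of `𝓗`). Let `Σ₁ = σ₁(L₁)`, `Σ₂ = σ₂(L₂)` be two
achronal spacelike embedded hypersurfaces of class `C²` (here: smooth embeddings of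
`3`-manifolds `Lₐ` with `σₐ^* g = hₐ` Riemannian) and `Sₐ = Σₐ ∩ 𝓗`. If `S₁ ⊆ J⁻(S₂)`, then
`Area(S₁) ≤ Area(S₂)`, where `Area(Sₐ) = ℌ²_{hₐ}(Sₐ)` is the `2`-dimensional Hausdorff measure for
the induced metric (CDGH (3.11); here `area hₐ (σₐ⁻¹ 𝓗)`, `Volume.lean`). (CDGH: "the generators
of `𝓗` are future complete and the null energy condition holds on `𝓗`"; §4.2: "`𝓗` is not
necessarily an event horizon, and the space–time does not have to satisfy any causality
conditions"; Rem. 6.2: the inequality of standard areas needs no disjointness of `S₁`, `S₂`.)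
Named fact (D-0014); universe-polymorphic in the carrier.
[cite: ChruscielEtAl2001, Thm. 1.1 (b), Thm. 6.1, Prop. 4.17] -/
def ChruscielEtAl2001_areaTheorem : Prop :=
  ∀ (𝓢 : Spacetime.{u} 4) [𝓢.metric.HasLeviCivita] (𝓗 : Set 𝓢.carrier),
    IsClosed 𝓗 → 𝓢.metric.IsAchronal 𝓢.timeOrientation 𝓗 → IsTopologicalSubmanifold 3 𝓗 →
    𝓢.IsRuledByCompleteNullGeodesics 𝓗 → 𝓢.SatisfiesNullConvergenceOn 𝓗 →
    ∀ (L₁ : Type u) [TopologicalSpace L₁] [ChartedSpace E3 L₁] [IsManifold (𝓡 3) ∞ L₁]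
      [T2Space L₁] [LocallyCompactSpace L₁] [MeasurableSpace L₁] [BorelSpace L₁]
      (L₂ : Type u) [TopologicalSpace L₂] [ChartedSpace E3 L₂] [IsManifold (𝓡 3) ∞ L₂]
      [T2Space L₂] [LocallyCompactSpace L₂] [MeasurableSpace L₂] [BorelSpace L₂]
      (σ₁ : L₁ → 𝓢.carrier) (σ₂ : L₂ → 𝓢.carrier)
      (h₁ : ContMDiffRiemannianMetric (𝓡 3) ∞ E3 (TangentSpace (𝓡 3) : L₁ → Type _))
      (h₂ : ContMDiffRiemannianMetric (𝓡 3) ∞ E3 (TangentSpace (𝓡 3) : L₂ → Type _)),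
      Manifold.IsSmoothEmbedding (𝓡 3) (𝓡 4) ∞ σ₁ →
      Manifold.IsSmoothEmbedding (𝓡 3) (𝓡 4) ∞ σ₂ →
      (∀ y, pullbackBilin (I := 𝓡 4) (I' := 𝓡 3) σ₁ 𝓢.metric.val y = h₁.inner y) →
      (∀ y, pullbackBilin (I := 𝓡 4) (I' := 𝓡 3) σ₂ 𝓢.metric.val y = h₂.inner y) →
      𝓢.metric.IsAchronal 𝓢.timeOrientation (range σ₁) →
      𝓢.metric.IsAchronal 𝓢.timeOrientation (range σ₂) →
      range σ₁ ∩ 𝓗 ⊆ 𝓢.metric.causalPast 𝓢.timeOrientation (range σ₂ ∩ 𝓗) →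
      area h₁ (σ₁ ⁻¹' 𝓗) ≤ area h₂ (σ₂ ⁻¹' 𝓗)

section AreaTheorem

variable {X : Type u} [TopologicalSpace X] [ChartedSpace E3 X] [IsManifold (𝓡 3) ∞ X]
  [ConnectedSpace X] {D : InitialDataSet (𝓡 3) X}

namespace EventHorizonArea

/-- **Monotonicity of the horizon area along an advanced-time foliation**, from the area theorem
(the named fact `ChruscielEtAl2001_areaTheorem`, hypothesis `hAT`) applied to the achronal
boundary `𝓗 = ∂I⁻(U)` and the leaves `σ_v`, `σ_w`: if `∂I⁻(U)` is achronal and an embedded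
topological hypersurface (which every nonempty achronal boundary is: Hawking–Ellis 1973,
Prop. 6.3.1), is ruled by future-complete null geodesics (CDGH hypothesis (b): the generators of
the horizon are future complete and never reach `Ū`), and the null energy condition holds on it,
then `v ↦ A.horizonArea v` is monotone. Chruściel–Delay–Galloway–Howard 2001, Thm. 1.1 (b).
[cite: ChruscielEtAl2001, Thm. 1.1 (b)] -/
theorem monotone_horizonArea (hAT : ChruscielEtAl2001_areaTheorem.{u})
    {𝒟 : CauchyDevelopment D} {U : Set 𝒟.carrier} (A : EventHorizonArea 𝒟 U)
    [𝒟.metric.HasLeviCivita]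
    (hach : 𝒟.metric.IsAchronal 𝒟.timeOrientation
      (frontier (𝒟.metric.chronologicalPast 𝒟.timeOrientation U)))
    (htop : IsTopologicalSubmanifold 3
      (frontier (𝒟.metric.chronologicalPast 𝒟.timeOrientation U)))
    (hgen : 𝒟.toSpacetime.IsRuledByCompleteNullGeodesics
      (frontier (𝒟.metric.chronologicalPast 𝒟.timeOrientation U)))
    (hnec : 𝒟.toSpacetime.SatisfiesNullConvergenceOn
      (frontier (𝒟.metric.chronologicalPast 𝒟.timeOrientation U))) :
    Monotone A.horizonArea := by
  intro v w hvw
  have key := hAT 𝒟.toSpacetime (frontier (𝒟.metric.chronologicalPast 𝒟.timeOrientation U))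
    isClosed_frontier hach htop hgen hnec A.Leaf A.Leaf (A.leaf v) (A.leaf w) (A.leafMetric v)
    (A.leafMetric w) (A.isSmoothEmbedding v) (A.isSmoothEmbedding w) (A.induced v) (A.induced w)
    (A.isAchronal v) (A.isAchronal w)
    (by
      rw [← A.range_inter_eventHorizon_eq, ← A.range_inter_eventHorizon_eq]
      exact A.inter_subset_causalPast hvw)
  simpa only [horizonArea, crossSection_eq_preimage_frontier] using key

end EventHorizonArea

/-- A vacuum Cauchy development satisfies the null energy condition on every subset (`Ric = 0`).
Hawking–Ellis 1973, §4.3, p. 95. [cite: HawkingEllis1973, §4.3, p. 95] -/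
theorem VacuumCauchyDevelopment.satisfiesNullConvergenceOn (𝒟 : VacuumCauchyDevelopment D)
    [𝒟.metric.HasLeviCivita] (S : Set 𝒟.carrier) :
    𝒟.toSpacetime.SatisfiesNullConvergenceOn S :=
  Spacetime.satisfiesNullConvergenceOn_of_isRicciFlat 𝒟.isRicciFlat S

/-- **The area theorem for vacuum Cauchy developments**: along any advanced-time foliation of the
event horizon `∂I⁻(U) ∩ J⁺(ι X)` of a vacuum Cauchy development, the horizon area is monotone,
provided `∂I⁻(U)` is an achronal embedded topological hypersurface ruled by future-complete null
geodesics — from the named fact `ChruscielEtAl2001_areaTheorem` (hypothesis `hAT`), the null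
energy condition being automatic in vacuum. Chruściel–Delay–Galloway–Howard 2001, Thm. 1.1 (b);
Hawking–Ellis 1973, Prop. 9.2.7. [cite: ChruscielEtAl2001, Thm. 1.1 (b)] -/
theorem VacuumCauchyDevelopment.monotone_horizonArea (hAT : ChruscielEtAl2001_areaTheorem.{u})
    (𝒟 : VacuumCauchyDevelopment D) [𝒟.metric.HasLeviCivita] {U : Set 𝒟.carrier}
    (A : EventHorizonArea 𝒟.toCauchyDevelopment U)
    (hach : 𝒟.metric.IsAchronal 𝒟.timeOrientation
      (frontier (𝒟.metric.chronologicalPast 𝒟.timeOrientation U)))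
    (htop : IsTopologicalSubmanifold 3
      (frontier (𝒟.metric.chronologicalPast 𝒟.timeOrientation U)))
    (hgen : 𝒟.toSpacetime.IsRuledByCompleteNullGeodesics
      (frontier (𝒟.metric.chronologicalPast 𝒟.timeOrientation U))) :
    Monotone A.horizonArea :=
  A.monotone_horizonArea hAT hach htop hgen (𝒟.satisfiesNullConvergenceOn _)

end AreaTheorem

/-! ### Penrose's heuristic bound on the area of horizon sections (schema; open) -/

section Penrose

variable {X : Type u} [TopologicalSpace X] [ChartedSpace E3 X] [IsManifold (𝓡 3) ∞ X]
  [ConnectedSpace X] {D : InitialDataSet (𝓡 3) X}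

/-- **Penrose's heuristic bound on the area of event-horizon sections — statement schema in the
identification of `I⁻(U)` with the past of future null infinity.** Penrose 1973; Mars, CQG 26
(2009) 193001, §2: for a spacetime with complete future null infinity `𝓘⁺` and event horizon
`𝓗 = ∂J⁻(𝓘⁺)`, satisfying the null energy condition, and an asymptotically flat (partial
Cauchy) slice with ADM energy `E_ADM` cutting `𝓗` in `S`, the chain "area theorem, settling to a
Kerr black hole, `A_Kerr = 8π M(M + √(M² − L²/M²)) ≤ 16π M²`, Bondi mass loss, Bondi mass →
ADM mass" yields `M_ADM ≥ √(|S|/16π)` for `S` and for every later cut — a **heuristic**, several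
links of which are open (Mars: "modulo several technical conditions that still remain open";
"only known under additional assumptions"). Rendered over `EventHorizonArea`: for every
**maximal vacuum** Cauchy development `𝒟` of the data `D`, with **complete future null
infinity** in Christodoulou's intrinsic sense (`LorentzianMetric.HasCompleteFutureNullInfinity`,
under the standing Levi-Civita instance), `D` being asymptotically flat of order `1` on an end
`e` which is the sole end of `X` and on which the ADM energy limit exists, for every far region
`U` **satisfying `IsPastOfNullInfinity 𝒟 U`** and every advanced-time foliation `A` of
`𝓗⁺ = ∂I⁻(U) ∩ J⁺(ι X)`: `A.horizonArea v ≤ 16π (e.admEnergy D)²` for all `v`.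
The predicate parameter `IsPastOfNullInfinity` stands for the identification
`I⁻(U) = M ∩ J⁻(𝓘⁺)` which the heuristic presupposes and which the `𝓘⁺`-free vocabulary of the
tree does not express (module docstring); Penrose's statement is this schema at that
identification. **Open** there, false for unrestricted `U` (e.g. at `fun _ _ ↦ True`), and
asserted at no instance: a `Prop`-valued schema, not a named fact, hence carrying no citation
tag of its own (sources: Penrose 1973; Mars 2009, §2). The ADM *energy* `E ≥ m` is used, the
weaker form. [folklore] -/
def PenroseHorizonAreaBound
    (IsPastOfNullInfinity : ∀ 𝒟 : CauchyDevelopment.{u} D, Set 𝒟.carrier → Prop) : Prop :=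
  ∀ (𝒟 : VacuumCauchyDevelopment.{u} D) [𝒟.metric.HasLeviCivita] (e : AFEnd X)
    (U : Set 𝒟.carrier) (A : EventHorizonArea 𝒟.toCauchyDevelopment U) (v : ℝ),
    𝒟.IsMaximal →
    𝒟.metric.HasCompleteFutureNullInfinity 𝒟.timeOrientation 𝒟.embed 𝒟.normal →
    e.IsSoleEnd → e.IsAsymptoticallyFlat D 1 → (∃ m, e.HasADMEnergy D m) →
    IsPastOfNullInfinity 𝒟.toCauchyDevelopment U →
    A.horizonArea v ≤ ENNReal.ofReal (16 * Real.pi * e.admEnergy D ^ 2)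

/-- Hypothesis form of the schema: if `PenroseHorizonAreaBound P` holds and `U` satisfies `P`,
every section of an advanced-time foliation of `𝓗⁺(U)` in a maximal vacuum Cauchy development
with complete future null infinity of asymptotically flat one-ended data has area at most
`16π E_ADM²`; in particular the horizon area is bounded along the foliation. Tautological
unfolding (Mars 2009, §2). [folklore] -/
theorem PenroseHorizonAreaBound.apply
    {IsPastOfNullInfinity : ∀ 𝒟 : CauchyDevelopment.{u} D, Set 𝒟.carrier → Prop}
    (h : PenroseHorizonAreaBound IsPastOfNullInfinity) (𝒟 : VacuumCauchyDevelopment.{u} D)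
    [𝒟.metric.HasLeviCivita] (e : AFEnd X) {U : Set 𝒟.carrier}
    (A : EventHorizonArea 𝒟.toCauchyDevelopment U) (hmax : 𝒟.IsMaximal)
    (hscri : 𝒟.metric.HasCompleteFutureNullInfinity 𝒟.timeOrientation 𝒟.embed 𝒟.normal)
    (hsole : e.IsSoleEnd) (hAF : e.IsAsymptoticallyFlat D 1) (hE : ∃ m, e.HasADMEnergy D m)
    (hU : IsPastOfNullInfinity 𝒟.toCauchyDevelopment U) (v : ℝ) :
    A.horizonArea v ≤ ENNReal.ofReal (16 * Real.pi * e.admEnergy D ^ 2) :=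
  h 𝒟 e U A v hmax hscri hsole hAF hE hU

end Penrose

end Literature.Geometry.Lorentzian

end
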